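import Summits.BirchSwinnertonDyer.BirchSwinnertonDyer.Theorems.SylvesterTwoHeegnerIndexUpperDescentQuadratic
import Summits.BirchSwinnertonDyer.BirchSwinnertonDyer.Theorems.GenusKolyvaginAtTwoLeafCensusShaCellByName
import Literature.NumberTheory.EllipticCurves.TwoTorsionOddDegreeBaseChangeProofs
import Literature.NumberTheory.EllipticCurves.SelmerGroupCardinality
import HarnessLib

/-!
# Route `GenusKolyvaginAtTwo`, crux `RankOneShaCellBSDTwo` (stmt-BirchSwinnertonDyer-27477): CLEAN DESCENT AT `2` ALONG A QUADRATIC FIELD for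
# curves WITHOUT rational `2`-torsion — `Ш(W/ℚ) ↪ Ш(W/K)` when the twist `W^{(d_K)}` has rank `0`, and the Ш-cell's «Selmer excess injects» (LEAD bsd-line-gk2-p1 g32)

Seat `bsd-line-gk2-p1` g32 (LEAD lineage, cell `bsd-f1-sign2`).  THEOREMS ONLY, standard axioms, no `sorry`.  **BSD is NOT proved by this file; the
Ш-cell `RankOneShaCellBSDTwo` (27477), U₂, the WALL rows and every research stub (DIV⁰|Ш, NDIV⁰|Ш) stay OPEN; nothing is closed.**

WHY.  Every line on the Ш-cell (the registered skeleton «sha_cell_twin_swap» v0.1; the pen's LINE 41 «restriction_rigidity» / LINE 42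
«kolyvagin_structure») runs over a Heegner field `K` and must compare `Ш(W/ℚ)[2^∞]` with `Ш(W_K)[2^∞]`.  At an ODD prime the comparison is free; at
`p = 2` the kernel of `H¹(ℚ, W) → H¹(K, W)` is `H¹(Gal(K/ℚ), W(K))`, a `2`-group.  The tree already holds the clean-descent criterion at `2`
(`SylvesterTwoUpper.shaRestriction_injective_of_torsion_quotient`: index `2` + «`W(K̃)/W(ℚ)` torsion» + «`W(K̃)[2] = 0`» ⟹ injective) and its
instantiation for the Sylvester curves `x³ + y³ = p`.  This file instantiates it for EVERY `W/ℚ` WITHOUT RATIONAL `2`-TORSION — exactly the Ш-cell's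
(and U₂'s) standing hypothesis `W(ℚ)[2] = 0`: the `2`-division cubic is then irreducible over `ℚ` and stays irreducible over a quadratic field
(`WeierstrassCurve.forall_two_nsmul_baseChange_of_finrank_eq_two`, Silverman Ex. III.3.7 (d)), so `W(K)[2] = 0` for every quadratic `K`.

* §1 `shaRestriction_injective_of_noTwoTorsion_of_rank_galoisClosure` / `…_quadratic` / ★ `…_of_twist_rank_zero`: for `W/ℚ` elliptic with
  `W(ℚ)[2] = 0` and `K/ℚ` quadratic with `rank W^{(d_K)}(ℚ) = 0`, **`Ш(W/ℚ) → Ш(W_K/K)` is INJECTIVE** (no power of `2` lost).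
* §2 ★ `shaRestriction_injective_of_noTwoTorsion_of_twist_lValue_ne_zero`: the FRAME form — `L(W^{(d_K)}, 1) ≠ 0` gives `rank W^{(d_K)}(ℚ) = 0` by
  GZK (`rank_eq_analyticRank_of_analyticRank_le_one` = route item `MultPublishedInputsAtTwo`) and modularity (`hasEntireLFunction_rat` = item
  `EntireLFunctionRat`), both displayed as hypotheses.
* §3 ★ `natCard_selmerTwo_dvd_two_mul_natCard_shaPrimary_baseChange`: at analytic rank one, **`#Sel₂(W) ∣ 2 · #Ш(W_K)[2^∞]`** (`#Sel₂(W) = 2·#Ш(W)[2]`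
  by the descent count and GZK, then Lagrange in `Ш(W_K)[2^∞]` through the injective restriction; void = `∣ 0` if `Ш(W_K)[2^∞]` is infinite), and
  `selmerExcessInjectsShaCellAtTwo_of_facts`: the pen's LINE 41 stub RIG `SelmerExcessInjectsShaCellAtTwo` VERBATIM, with the two PRINT facts it
  silently needs (GZK, modularity) PREPENDED — RIG as typed (no GZK binder) is not provable from the tree, since `#Sel₂(W)` carries `2^{rank W(ℚ)}`.
So on every frame of the Ш-cell the step `ℚ → K` of the Kolyvagin road costs NO power of `2` on the `W`-side: `Ш(W)[2^∞] ↪ Ш(W_K)[2^∞]`, and the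
cell's defining excess `#Sel₂(W) ≥ 8` is visible in `Ш(W_K)[2^∞]` (forced co-depth `M₀ ≥ 1` under DIV⁰|Ш, as LINE 41 observes).

References: [SilvermanAEC2009] Ex. III.3.7 (d), VIII.§1, Ex. 10.16, X.§4 Thm 4.2; [SerreGaloisCohomology1997] I.§5.8; [GrossLMS1991] §2;
[Darmon2004] §3.9, Ex. 3.18; [Kramer1981] §2.
-/

set_option autoImplicit false
set_option linter.dupNamespace false -- `Summit.<P>.<Sub>` repeats `BirchSwinnertonDyer` (D-0017)

noncomputable section

open scoped Classical NumberField

universe u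

namespace Summit.BirchSwinnertonDyer.BirchSwinnertonDyer.Theorems.GenusExact.ShaCell.CleanDescent

open Literature.NumberTheory.EllipticCurves WeierstrassCurve
  Summit.BirchSwinnertonDyer.BirchSwinnertonDyer.Theorems.SylvesterTwoUpper
open Summit.BirchSwinnertonDyer.BirchSwinnertonDyer.Theorems.GenusExact.TwinSwap.AnalyticTwin.NoTwoTorsion.Census
  (forall_two_smul_eq_zero_iff_natCard_torsionBy_eq_one)

/-! ## §1 `Ш(W/ℚ) ↪ Ш(W_K/K)` for `W(ℚ)[2] = 0`, `K` quadratic, no new rank -/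

/-- **Clean descent at `2`, Galois-closure form** (any number field `K`).  `W/K` elliptic without `K`-rational `2`-torsion, `L ⊇ K` a number
field whose Galois closure `L̃ ⊆ K̄` has `[L̃ : K] = 2`, and `rank W(L̃) = rank W(K)`: then `Ш(W/K) → Ш(W_L/L)` is injective.  The tree's criterion
`shaRestriction_injective_of_torsion_quotient` with its two inputs discharged: «`W(L̃)/W(K)` torsion» from the rank equality (Mordell–Weil over `L̃`,
`exists_nsmul_mem_baseChange_of_mordellWeilRank_eq`) and «`W(L̃)[2] = 0`» from `W(K)[2] = 0` and `[L̃ : K] = 2`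
(`forall_two_nsmul_baseChange_of_finrank_eq_two`: the `2`-division cubic stays irreducible in a quadratic extension).
[cite: SilvermanAEC2009, Ex. III.3.7 (d) and X.§4] [cite: SerreGaloisCohomology1997, I.§5.8] -/
theorem shaRestriction_injective_of_noTwoTorsion_of_rank_galoisClosure {K : Type u} [Field K] [NumberField K]
    (W : WeierstrassCurve K) [W.IsElliptic] (hT : ∀ P : W.toAffine.Point, 2 • P = 0 → P = 0)
    (L : Type u) [Field L] [NumberField L] [Algebra K L]
    (hL : Module.finrank K (galoisClosureIn (K := K) L) = 2)
    (hrank : (W.baseChange (galoisClosureIn (K := K) L)).mordellWeilRank = W.mordellWeilRank) :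
    Function.Injective (shaRestriction W L) := by
  -- Mordell–Weil over the number field `L̃`
  haveI : (W.baseChange (galoisClosureIn (K := K) L)).IsElliptic := by
    rw [WeierstrassCurve.baseChange]; infer_instance
  have hfg := (W.baseChange (galoisClosureIn (K := K) L)).addGroup_fg_point_holds
  haveI : AddGroup.FG (W.baseChange (galoisClosureIn (K := K) L)).toAffine.Point := by convert hfg
  haveI : Module.Finite ℤ (W.baseChange (galoisClosureIn (K := K) L)).toAffine.Point :=
    Module.Finite.iff_addGroup_fg.mpr inferInstance
  have h2 : (galSubgroupClosure (K := K) L).index = 2 := by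
    rw [Literature.NumberTheory.EllipticCurves.index_galSubgroupClosure_eq_finrank]; convert hL
  refine shaRestriction_injective_of_torsion_quotient W L h2
    (exists_nsmul_mem_baseChange_of_mordellWeilRank_eq W _ hrank) (fun Q hQ ↦ ?_)
  -- (the generic lemma reads the group law on `W(L̃)` under the classical `DecidableEq L̃`, this file under the subtype
  -- instance inherited from `K̄`; `convert` bridges the two subsingleton instances)
  exact W.forall_two_nsmul_baseChange_of_finrank_eq_two (L := galoisClosureIn (K := K) L) two_ne_zero hT
    (by convert hL) Q (by convert hQ)

/-- **Clean descent at `2` along a quadratic field, rank form.** `W/ℚ` elliptic with `W(ℚ)[2] = 0`, `[K′ : ℚ] = 2` and `rank W(K′) = rank W(ℚ)`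
⟹ `Ш(W/ℚ) ↪ Ш(W_{K′}/K′)`.  A quadratic extension is normal, so `[K̃′ : ℚ] = 2` (`finrank_galoisClosureIn_eq_of_normal`) and
`rank W(K̃′) = rank W(K′)` (`mordellWeilRank_baseChange_galoisClosureIn_eq`). [cite: SilvermanAEC2009, X.§4] [cite: GrossLMS1991, §2] -/
theorem shaRestriction_injective_of_noTwoTorsion_quadratic (W : WeierstrassCurve ℚ) [W.IsElliptic]
    (hT : ∀ P : W.toAffine.Point, 2 • P = 0 → P = 0)
    (K' : Type) [Field K'] [NumberField K'] (hK : Module.finrank ℚ K' = 2)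
    (hrank : (W.baseChange K').mordellWeilRank = W.mordellWeilRank) :
    Function.Injective (shaRestriction W K') := by
  haveI : Algebra.IsQuadraticExtension ℚ K' := { finrank_eq_two' := hK }
  refine shaRestriction_injective_of_noTwoTorsion_of_rank_galoisClosure W (fun P hP ↦ hT P (by convert hP)) K' ?_ ?_
  · -- `[K̃′ : ℚ] = [K′ : ℚ] = 2` (a quadratic extension is normal)
    have h := finrank_galoisClosureIn_eq_of_normal (K := ℚ) K'
    rw [hK] at h
    convert h using 2
  · -- `rank W(K̃′) = rank W(K′) = rank W(ℚ)`
    have h1 := mordellWeilRank_baseChange_galoisClosureIn_eq (K := ℚ) K' W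
    rw [hrank] at h1
    convert h1 using 2

/-- ★ **Clean descent at `2`, FRAME (twist) form: `W(ℚ)[2] = 0`, `[K′ : ℚ] = 2`, `rank W^{(d_{K′})}(ℚ) = 0` ⟹ `Ш(W/ℚ) ↪ Ш(W_{K′}/K′)`.**  The tree's
quadratic base-change identity `rank W(K′) = rank W(ℚ) + rank W^{(d_{K′})}(ℚ)` (`mordellWeilRank_baseChange_of_finrank_eq_two_of_finite`) turns «twin of
rank `0`» into «no new rank over `K′`».  For general `W/ℚ` (the Sylvester-curve case is `shaRestriction_injective_sylvester_of_twist_rank_zero`).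
[cite: SilvermanAEC2009, Exercise 10.16 and X.§4] [cite: GrossLMS1991, §2] [cite: Kramer1981, §2] -/
theorem shaRestriction_injective_of_noTwoTorsion_of_twist_rank_zero (W : WeierstrassCurve ℚ) [W.IsElliptic]
    (hT : ∀ P : W.toAffine.Point, 2 • P = 0 → P = 0)
    (K' : Type) [Field K'] [NumberField K'] (hK : Module.finrank ℚ K' = 2)
    (htwist : (W.quadraticTwist (NumberField.discr K' : ℚ)).mordellWeilRank = 0) :
    Function.Injective (shaRestriction W K') := by
  haveI : (W.baseChange K').IsElliptic := by rw [WeierstrassCurve.baseChange]; infer_instance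
  have hfg := (W.baseChange K').addGroup_fg_point_holds
  haveI : AddGroup.FG (W.baseChange K').toAffine.Point := by convert hfg
  haveI : Module.Finite ℤ (W.baseChange K').toAffine.Point := Module.Finite.iff_addGroup_fg.mpr inferInstance
  have hrank : (W.baseChange K').mordellWeilRank = W.mordellWeilRank := by
    have h := mordellWeilRank_baseChange_of_finrank_eq_two_of_finite W K' hK
    rw [htwist, add_zero] at h
    convert h using 1
  exact shaRestriction_injective_of_noTwoTorsion_quadratic W hT K' hK hrank

/-! ## §2 The frame form over an `L`-value: `L(W^{(d_K)}, 1) ≠ 0` ⟹ `Ш(W/ℚ) ↪ Ш(W_K/K)` (modulo GZK + modularity) -/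

/-- ★ **On every frame with `L(W^{(d_K)}, 1) ≠ 0`, a curve without rational `2`-torsion loses NO power of `2` in `Ш(W/ℚ) → Ш(W_K/K)`.**  `K/ℚ`
quadratic (e.g. a Heegner field); the twist `W^{(d_K)}` has analytic rank `0` (modularity: `analyticRank_eq_zero_iff_holds`), hence Mordell–Weil
rank `0` by GZK (`rank_eq_analyticRank_of_analyticRank_le_one`, displayed); then §1.  CONDITIONAL on the two displayed PRINT facts.
[cite: GrossZagier1986, V.§2 (2.2)] [cite: Kolyvagin1990, Thm. A] [cite: BCDTJAMS2001, Thm. A] [cite: SilvermanAEC2009, X.§4] -/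
theorem shaRestriction_injective_of_noTwoTorsion_of_twist_lValue_ne_zero
    (hGZK : rank_eq_analyticRank_of_analyticRank_le_one) (hmod : hasEntireLFunction_rat)
    (W : WeierstrassCurve ℚ) [W.IsElliptic] (hT : ∀ P : W.toAffine.Point, 2 • P = 0 → P = 0)
    (K : Type) [Field K] [NumberField K] (hK : Module.finrank ℚ K = 2)
    (hL : (W.quadraticTwist (NumberField.discr K : ℚ)).entireLFunction 1 ≠ 0) :
    Function.Injective (shaRestriction W K) := by
  have hD0 : (NumberField.discr K : ℚ) ≠ 0 := by exact_mod_cast NumberField.discr_ne_zero K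
  haveI := W.isElliptic_quadraticTwist hD0
  have hr0 : (W.quadraticTwist (NumberField.discr K : ℚ)).analyticRank = 0 :=
    ((W.quadraticTwist (NumberField.discr K : ℚ)).analyticRank_eq_zero_iff_holds (hmod _)).mpr hL
  have htwist : (W.quadraticTwist (NumberField.discr K : ℚ)).mordellWeilRank = 0 := by
    have h := (hGZK (W.quadraticTwist (NumberField.discr K : ℚ)) (by rw [hr0]; exact Nat.zero_le 1)).1
    rw [hr0] at h
    convert h using 1
  exact shaRestriction_injective_of_noTwoTorsion_of_twist_rank_zero W hT K hK htwist

/-! ## §3 The Ш-cell's «Selmer excess injects»: `#Sel₂(W) ∣ 2 · #Ш(W_K)[2^∞]` at analytic rank one -/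

/-- **`Ш(W/ℚ)[2]` embeds in `Ш(W_K)[2^∞]` as a subgroup, so its order divides** (Lagrange; `∣ 0` when `Ш(W_K)[2^∞]` is infinite): for an injective
restriction `Ш(W/ℚ) → Ш(W_K/K)`, `#(Ш(W) ⊓ H¹(ℚ,W)[2]) ∣ #Ш(W_K)[2^∞]`. [folklore] -/
theorem natCard_sha_inf_torsionBy_two_dvd_natCard_shaPrimary_of_injective (W : WeierstrassCurve ℚ) [W.IsElliptic]
    (K : Type) [Field K] [NumberField K] (hinj : Function.Injective (shaRestriction W K)) :
    Nat.card (W.sha ⊓ AddSubgroup.torsionBy W.galH1 (2 : ℕ) : AddSubgroup W.galH1) ∣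
      Nat.card (AddCommGroup.primaryComponent (W.baseChange K).sha 2) := by
  -- the restriction, precomposed with `Ш ⊓ H¹[2] ≤ Ш` and corestricted to the `2`-primary part
  set H : AddSubgroup W.galH1 := W.sha ⊓ AddSubgroup.torsionBy W.galH1 (2 : ℕ) with hH
  let ι : H →+ W.sha := AddSubgroup.inclusion inf_le_left
  let g : H →+ (W.baseChange K).sha := (shaRestriction W K).comp ι
  have hg2 : ∀ c : H, (2 : ℕ) • g c = 0 := by
    intro c
    have hc2 : (2 : ℕ) • (c : W.galH1) = 0 := AddSubgroup.torsionBy.nsmul_iff.mp (AddSubgroup.mem_inf.mp c.2).2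
    apply Subtype.ext
    simp only [g, ι, AddMonoidHom.coe_comp, Function.comp_apply, AddSubgroupClass.coe_nsmul, coe_shaRestriction_apply,
      AddSubgroup.coe_inclusion, ZeroMemClass.coe_zero]
    rw [← map_nsmul, hc2, map_zero]
  have hmem : ∀ c : H, g c ∈ AddCommGroup.primaryComponent (W.baseChange K).sha 2 := fun c ↦
    AddCommGroup.mem_primaryComponent.mpr ⟨1, by rw [pow_one]; exact_mod_cast hg2 c⟩
  let φ : H →+ AddCommGroup.primaryComponent (W.baseChange K).sha 2 := g.codRestrict _ hmem
  have hφ : Function.Injective φ := by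
    intro a b hab
    have h1 : g a = g b := by
      have := congrArg Subtype.val hab
      simpa [φ] using this
    exact AddSubgroup.inclusion_injective inf_le_left (hinj h1)
  exact AddSubgroup.card_dvd_of_injective φ hφ

/-- ★ **«SELMER EXCESS INJECTS»: at analytic rank one, for `W(ℚ)[2] = 0` and a quadratic `K` with `L(W^{(d_K)}, 1) ≠ 0`, `#Sel₂(W) ∣ 2 · #Ш(W_K)[2^∞]`.**
`#Sel₂(W) = 2^{rank}·#W(ℚ)[2]·#Ш(W)[2]` (descent count `card_selmerGroup_eq_pow_rank_mul`, Silverman X.4.2) `= 2·#Ш(W)[2]` (rank `1` by GZK, no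
`2`-torsion); `Ш(W)[2] ↪ Ш(W_K)[2^∞]` by §2; Lagrange.  CONDITIONAL on GZK + modularity (displayed).  On the Ш-cell (`#Sel₂(W) ≥ 8`) this forces
`4 ∣ #Ш(W_K)[2^∞]`, i.e. exact `2`-depth `M₀ ≥ 1` under the upper half DIV⁰|Ш — the cell has no depth-zero frame.
[cite: SilvermanAEC2009, Thm X.4.2] [cite: GrossZagier1986, V.§2 (2.2)] [cite: Kramer1981, §2] -/
theorem natCard_selmerTwo_dvd_two_mul_natCard_shaPrimary_baseChange
    (hGZK : rank_eq_analyticRank_of_analyticRank_le_one) (hmod : hasEntireLFunction_rat)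
    (W : WeierstrassCurve ℚ) [W.IsElliptic] (hT : ∀ P : W.toAffine.Point, 2 • P = 0 → P = 0) (hr : W.analyticRank = 1)
    (K : Type) [Field K] [NumberField K] (hK : Module.finrank ℚ K = 2)
    (hL : (W.quadraticTwist (NumberField.discr K : ℚ)).entireLFunction 1 ≠ 0) :
    Nat.card (W.selmerGroup 2) ∣ 2 * Nat.card (AddCommGroup.primaryComponent (W.baseChange K).sha 2) := by
  have hinj := shaRestriction_injective_of_noTwoTorsion_of_twist_lValue_ne_zero hGZK hmod W hT K hK hL
  have h1 : W.mordellWeilRank = 1 := ((hGZK W hr.le).1).trans hr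
  have hcount := card_selmerGroup_eq_pow_rank_mul W 2
  simp only [Nat.cast_ofNat] at hcount
  have htors := (forall_two_smul_eq_zero_iff_natCard_torsionBy_eq_one W).mp (fun P hP ↦ hT P (by convert hP))
  rw [hcount, h1, pow_one, htors, mul_one]
  exact mul_dvd_mul_left 2 (natCard_sha_inf_torsionBy_two_dvd_natCard_shaPrimary_of_injective W K hinj)

/-- **The pen's LINE 41 stub RIG `SelmerExcessInjectsShaCellAtTwo` — VERBATIM text, with the two PRINT facts it needs PREPENDED** (GZK = route item
`MultPublishedInputsAtTwo`, modularity = item `EntireLFunctionRat`; as typed in LINE 41 v1.1 the stub has no such binder and is then not provable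
from the tree: `#Sel₂(W)` carries the factor `2^{rank W(ℚ)}`, and only GZK bounds the rank by the analytic rank).  The Ш-cell binders non-CM /
`#Sel₂ ≠ 2` / odd `d_K` / `d_K ≠ −3` / Heegner / `2` split / the minimal twin model are NOT used: the divisibility holds on every quadratic frame with
`L(W^{(d_K)},1) ≠ 0`.  CONDITIONAL; proves nothing about BSD; closes nothing (LINE 41 is unregistered).
[cite: SilvermanAEC2009, Thm X.4.2] [cite: GrossZagier1986, V.§2 (2.2)] [cite: Kramer1981, §2] -/
theorem selmerExcessInjectsShaCellAtTwo_of_facts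
    (hGZK : rank_eq_analyticRank_of_analyticRank_le_one) (hmod : hasEntireLFunction_rat) :
    ∀ (W : WeierstrassCurve ℚ) [W.IsElliptic] [W.IsGloballyMinimal] [NeZero (W.conductorNorm ℤ)],
      ¬ W.HasCM → W.analyticRank = 1 → (∀ P : W.toAffine.Point, 2 • P = 0 → P = 0) → Nat.card (W.selmerGroup 2) ≠ 2 →
      ∀ (K : Type) [Field K] [NumberField K], IsImaginaryQuadratic K →
        Odd (NumberField.discr K) → NumberField.discr K ≠ -3 → SatisfiesHeegnerHypothesis (W.conductorNorm ℤ) K →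
        ((Ideal.span {(2 : ℤ)}).primesOver (𝓞 K)).ncard = 2 →
        ∀ (Wd : WeierstrassCurve ℚ) [Wd.IsElliptic] [Wd.IsGloballyMinimal],
          (∃ C : VariableChange ℚ, C • W.quadraticTwist (NumberField.discr K : ℚ) = Wd) →
        (W.quadraticTwist (NumberField.discr K : ℚ)).entireLFunction 1 ≠ 0 →
          Nat.card (W.selmerGroup 2) ∣ 2 * Nat.card (AddCommGroup.primaryComponent (W.baseChange K).sha 2) := by
  intro W _ _ _ _ hr hT _ K _ _ hK _ _ _ _ Wd _ _ _ hL
  exact natCard_selmerTwo_dvd_two_mul_natCard_shaPrimary_baseChange hGZK hmod W hT hr K hK.1 hL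

end Summit.BirchSwinnertonDyer.BirchSwinnertonDyer.Theorems.GenusExact.ShaCell.CleanDescent

end
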